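import Summits.HodgeConjecture.HodgeConjecture.Theorems.Ring2AbelianAllAndreProductPencilsNodes
import Summits.HodgeConjecture.HodgeConjecture.Theorems.Ring2AbelianAllAndreSporadicClassesRank
import HarnessLib

/-!
# Ring 2 · sub-cell AbelianAll (ALL ABELIAN VARIETIES), André axis, part XXXII-d — THE PADDING IS AN EMBEDDING: the scalars of
# part XXXII-a's two base changes are UNITS; the fibrewise slice Gysin map `σ_{s!}` embeds the invariant algebraic classes of `𝒳_s`
# into those of `B × 𝒳_s` and REFLECTS the lifted ones; so the LIFT DEFECT `δ_p(f, s) = dim N^p_inv(𝒳_s) − r_p(f)` of parts XXX-d /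
# XXXI-c does not decrease under padding: `δ_p(f, s) ≤ δ_{p + dim B}(B × 𝒳 ⟶ S, s)` — FACT-FREE

HONEST FRAMING (page 1, verbatim): **research route, not a corollary; conditional on HC_CM plus one named
minimal statement.** Cell line: research route conditional on HC_CM; not a corollary; Q11.4-sentence-2 already
refuted in dim ≥ 3. Nothing in this file proves a case of the Hodge conjecture; `HC_CM`, `HC_AV` do not occur; no node is
born (0 `def`), no named fact, no `sorry`; axioms standard; nothing is claimed minimal; `B_min` of record (N104) untouched.

## What this part does

Part XXXII-a proved the two base changes of the Gysin padding up to ONE scalar each — `j_s^* pr_! = c · pr'_! (B ◁ j_s)^*` and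
`(B ◁ j_s)^* σ_! = K · σ_{s!} j_s^*` — which was enough for memberships. Here (§1, `exists_ne_zero_baseChange_scalars`) **both
scalars are UNITS**: read the identities on `σ_! 1`, using `pr_! σ_! = id`, `j_s^* 1 = 1` and `1 ≠ 0` in `H⁰(𝒳_s(ℂ))`
(`one_fiber_ne_zero`: `H⁰` of the fibre is the line `ℂ · 1` and contains a non-zero fibre integral, the tree's
`exists_complexGysin_snd_map_fst_ne_zero`). Consequently (§2) the FIBREWISE slice Gysin map
`σ_{s!} : H²ᵖ(𝒳_s(ℂ)) → H^{2(p+r)}((B × 𝒳_s)(ℂ))` (injective: `slice_gysin_fiber_injective`)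
* maps the INVARIANT ALGEBRAIC classes `N^p(𝒳_s) ∩ Im j_s^*` into `N^{p+r}(B × 𝒳_s) ∩ Im (B ◁ j_s)^*`
  (`slice_gysin_fiber_mem_inf_range`: `σ_{s!} j_s^* W = K⁻¹ (B ◁ j_s)^* σ_! W`),
* maps the LIFTED classes `j_s^* N^p(𝒳)` into `(B ◁ j_s)^* N^{p+r}(B × 𝒳)` (`slice_gysin_fiber_mem_map`),
* and REFLECTS the lifted classes (`mem_map_of_slice_gysin_fiber_mem_map`: `x = pr'_! σ_{s!} x = c⁻¹ j_s^* pr_! η`),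
so that `σ_{s!}` induces an INJECTION of obstruction spaces `N^p_inv(𝒳_s) / j_s^* N^p(𝒳) ↪ N^{p+r}_inv(B × 𝒳_s) / (B ◁ j_s)^* N^{p+r}(B × 𝒳)`;
(§3) read through the chart `B × 𝒳_s ≅ (B × 𝒳)_s` on a compact pencil of abelian varieties, with `r_p(f) = dim j_s^* N^p(𝒳)` the
lifted rank and `dim (N^p(𝒳_s) ∩ Im j_s^*)` the invariant algebraic rank of parts XXX-d / XXXI-c:
**`finrank_inf_range_add_le_of_snd_comp`** — `dim N^p_inv(𝒳_s) + r_{p + dim B}(B × 𝒳 ⟶ S) ≤ dim N^{p + dim B}_inv((B × 𝒳)_s) + r_p(f)`,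
i.e. THE LIFT DEFECT `δ_p(f, s) := dim N^p_inv(𝒳_s) − r_p(f)` satisfies `δ_p(f, s) ≤ δ_{p + dim B}(B × 𝒳 ⟶ S, s)` for every `s`,
every `p`, every abelian `B` (the linear-algebra step `finrank_add_finrank_le_of_quotient_injective`). Since `(L)_s(p) ⟺ δ_p(f, s) = 0`
(part XXX-d `comap_le_sup_iff_finrank_le`, fact-free), this QUANTIFIES part XXXII-b (`comap_le_sup_of_snd_comp_of_finrank` re-derives
its padding step): in the language of part XXXI-c, a jump point of the invariant algebraic rank of `f` in degree `2p` with excess `δ`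
is a point where the padded pencil has defect `≥ δ` in degree `2(p + dim B)` — the exceptional sets only grow, `E_p(f) ⊆ E_{p+dim B}(B × 𝒳)`.

What is NOT claimed: equality of the defects (the invariant algebraic classes of `B × 𝒳_s` outside `σ_{s!}`'s image — e.g.
non-exterior classes when `B` and `𝒳_s` share complex multiplication — may carry further defect); anything about `HC_CM`; any
case of HC. EDGE LABELS: every row K (fact-free); §1–§2 for every smooth projective family with smooth projective total space
over a separated base and every smooth projective `B` with a point, §3 for compact pencils of abelian varieties and abelian `B`.

References: Fulton1998 (Prop. 1.7, Thm. 6.2 (a)); FultonYoungTableaux1997 (App. B §B.1 (5)–(6)); HatcherAT2002 (§3.2 Prop. 3.10,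
§3.3 Thm. 3.26); Milne2020HodgeClassesAV (Prop. 1, p. 8); Kleiman1968AlgebraicCycles (§3); BrosnanFangNiePearlstein2009 (§6 Lemma 48).
-/

noncomputable section

set_option linter.dupNamespace false

namespace Summit.HodgeConjecture.HodgeConjecture.Ring2.AbelianAll

open CategoryTheory CategoryTheory.Limits AlgebraicGeometry MonoidalCategory CartesianMonoidalCategory
open Literature.AlgebraicGeometry Literature.AlgebraicGeometry.Motives
open Literature.AlgebraicGeometry.HodgeTheory
open Literature.AlgebraicTopology.SingularHomology (singularCohomology)
open Literature.AlgebraicGeometry.Deligne1982 (cmLocus)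
open Summit.HodgeConjecture.HodgeConjecture
open Summit.HodgeConjecture.HodgeConjecture.Theses

variable {𝒳 S : SchemeOver ℂ}

/-! ## §1 The scalars of the two base changes are units -/

section Scalars

variable {N d r : ℕ} {f : 𝒳 ⟶ S} (μ : OrientationFamily) (hX : IsSmoothProjective N 𝒳)
  (hf : IsSmoothProjectiveFamily f d) {B : SchemeOver ℂ} (hB : IsSmoothProjective r B) (b₀ : ComplexPoints B)

/-- `1 ≠ 0` in `H⁰(𝒳_s(ℂ); ℂ)`: `H⁰` of the (non-empty, connected) fibre is the line `ℂ · 1` (`exists_eq_smul_one`) and contains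
the non-zero fibre integral of a top class of `𝒳_s × 𝒳_s` (`exists_complexGysin_snd_map_fst_ne_zero`). [cite: HatcherAT2002, §3.3 Thm. 3.26] -/
theorem one_fiber_ne_zero (μ : OrientationFamily) (hf : IsSmoothProjectiveFamily f d) (s : ComplexPoints S) :
    singularCohomology.one ℂ (ComplexPoints (fiberOver f s)) ≠ 0 := by
  intro h0
  obtain ⟨w, hw⟩ := exists_complexGysin_snd_map_fst_ne_zero μ (hf.isSmoothProjective s) (hf.isSmoothProjective s)
  obtain ⟨t, ht⟩ := exists_eq_smul_one μ (hf.isSmoothProjective s)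
    (complexGysin μ (IsSmoothProjective.tensor_holds (hf.isSmoothProjective s) (hf.isSmoothProjective s))
      (hf.isSmoothProjective s) (snd (fiberOver f s) (fiberOver f s)) (show 2 * d + 2 * d = 0 + 2 * (d + d) by omega)
      (complexBetti.map (fst (fiberOver f s) (fiberOver f s)) (2 * d) w))
  rw [h0, smul_zero] at ht
  exact hw ht

/-- `j_s^* 1 = 1`. [cite: HatcherAT2002, §3.2 Prop. 3.10] -/
theorem map_fiberι_one (f : 𝒳 ⟶ S) (s : ComplexPoints S) :
    complexBetti.map (fiberι f s) 0 (singularCohomology.one ℂ (ComplexPoints 𝒳)) =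
      singularCohomology.one ℂ (ComplexPoints (fiberOver f s)) :=
  singularCohomology.map_one _

include hf in
/-- **The scalar of the projection base change is a unit and so is the scalar of the slice base change**: both are read off
the class `1 ∈ H⁰(𝒳(ℂ))`, `j_s^* pr_! σ_! 1 = j_s^* 1 = 1 ≠ 0`. [cite: Fulton1998, Prop. 1.7 and Thm. 6.2 (a)] -/
theorem exists_ne_zero_baseChange_scalars [IsSeparated S.hom] (s : ComplexPoints S) :
    ∃ c K : ℂ, c ≠ 0 ∧ K ≠ 0 ∧
      (∀ ⦃k k₁ : ℕ⦄ (hk : k + 2 * N = k₁ + 2 * (r + N)) (u : complexBetti (B ⊗ 𝒳) k),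
        complexBetti.map (fiberι f s) k₁ (complexGysin μ (IsSmoothProjective.tensor_holds hB hX) hX (snd B 𝒳) hk u) =
          c • complexGysin μ (IsSmoothProjective.tensor_holds hB (hf.isSmoothProjective s)) (hf.isSmoothProjective s)
            (snd B (fiberOver f s)) (show k + 2 * d = k₁ + 2 * (r + d) by omega) (complexBetti.map (B ◁ fiberι f s) k u)) ∧
      (∀ ⦃a b : ℕ⦄ (hab : a + 2 * (r + N) = b + 2 * N) (y : complexBetti 𝒳 a),
        complexBetti.map (B ◁ fiberι f s) b
            (complexGysin μ hX (IsSmoothProjective.tensor_holds hB hX) (lift (toSpecOver 𝒳 ≫ b₀) (𝟙 𝒳)) hab y) =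
          K • complexGysin μ (hf.isSmoothProjective s) (IsSmoothProjective.tensor_holds hB (hf.isSmoothProjective s))
            (lift (toSpecOver (fiberOver f s) ≫ b₀) (𝟙 (fiberOver f s))) (show a + 2 * (r + d) = b + 2 * d by omega)
            (complexBetti.map (fiberι f s) a y)) := by
  obtain ⟨c, hc⟩ := exists_map_fiberι_snd_gysin_eq_smul μ hX hf hB s
  obtain ⟨K, hK⟩ := exists_map_whiskerLeft_slice_gysin_eq_smul μ hX hf hB b₀ s
  -- read both identities on `σ_! 1`
  have h1 : complexBetti.map (fiberι f s) 0
      (complexGysin μ (IsSmoothProjective.tensor_holds hB hX) hX (snd B 𝒳)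
        (show 2 * (0 + r) + 2 * N = 2 * 0 + 2 * (r + N) by omega)
        (complexGysin μ hX (IsSmoothProjective.tensor_holds hB hX) (lift (toSpecOver 𝒳 ≫ b₀) (𝟙 𝒳))
          (show 2 * 0 + 2 * (r + N) = 2 * (0 + r) + 2 * N by omega) (singularCohomology.one ℂ (ComplexPoints 𝒳)))) ≠ 0 := by
    rw [snd_gysin_slice_gysin μ hX hB b₀ 0, map_fiberι_one]
    exact one_fiber_ne_zero μ hf s
  have hc0 : c ≠ 0 := by
    intro hc0
    apply h1
    rw [hc, hc0, zero_smul]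
  have hK0 : K ≠ 0 := by
    intro hK0
    apply h1
    rw [hc, hK, hK0, zero_smul, map_zero, smul_zero]
  exact ⟨c, K, hc0, hK0, hc, hK⟩

end Scalars

/-! ## §2 The fibrewise slice Gysin map embeds the invariant algebraic classes and reflects the lifted ones -/

section Embedding

variable {N d r : ℕ} {f : 𝒳 ⟶ S} (μ : OrientationFamily) (hX : IsSmoothProjective N 𝒳)
  (hf : IsSmoothProjectiveFamily f d) {B : SchemeOver ℂ} (hB : IsSmoothProjective r B) (b₀ : ComplexPoints B)

/-- `σ_{s!} : H²ᵖ(𝒳_s(ℂ)) → H^{2(p+r)}((B × 𝒳_s)(ℂ))` is injective (`pr'_! σ_{s!} = id`). [cite: FultonYoungTableaux1997, App. B §B.1 (5)] -/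
theorem slice_gysin_fiber_injective (s : ComplexPoints S) (p : ℕ) :
    Function.Injective (complexGysin μ (hf.isSmoothProjective s)
      (IsSmoothProjective.tensor_holds hB (hf.isSmoothProjective s))
      (lift (toSpecOver (fiberOver f s) ≫ b₀) (𝟙 (fiberOver f s))) (show 2 * p + 2 * (r + d) = 2 * (p + r) + 2 * d by omega)) :=
  Function.LeftInverse.injective (g := complexGysin μ (IsSmoothProjective.tensor_holds hB (hf.isSmoothProjective s))
      (hf.isSmoothProjective s) (snd B (fiberOver f s)) (show 2 * (p + r) + 2 * d = 2 * p + 2 * (r + d) by omega))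
    (snd_gysin_slice_gysin μ (hf.isSmoothProjective s) hB b₀ p)

variable [IsSeparated S.hom]

include hX in
/-- **`σ_{s!}` maps `N^p(𝒳_s) ∩ Im j_s^*` into `N^{p+r}(B × 𝒳_s) ∩ Im (B ◁ j_s)^*`** (`σ_{s!} j_s^* W = K⁻¹ (B ◁ j_s)^* σ_! W`).
[cite: Fulton1998, Thm. 6.2 (a)] -/
theorem slice_gysin_fiber_mem_inf_range (s : ComplexPoints S) {p : ℕ} {x : complexBetti (fiberOver f s) (2 * p)}
    (hx : x ∈ algebraicClasses (fiberOver f s) p ⊓ LinearMap.range (complexBetti.map (fiberι f s) (2 * p)).hom) :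
    complexGysin μ (hf.isSmoothProjective s) (IsSmoothProjective.tensor_holds hB (hf.isSmoothProjective s))
        (lift (toSpecOver (fiberOver f s) ≫ b₀) (𝟙 (fiberOver f s))) (show 2 * p + 2 * (r + d) = 2 * (p + r) + 2 * d by omega) x ∈
      algebraicClasses (B ⊗ fiberOver f s) (p + r) ⊓ LinearMap.range (complexBetti.map (B ◁ fiberι f s) (2 * (p + r))).hom := by
  obtain ⟨hxN, ⟨W, hW⟩⟩ := hx
  obtain ⟨c, K, -, hK0, -, hK⟩ := exists_ne_zero_baseChange_scalars μ hX hf hB b₀ s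
  refine ⟨complexGysin_mem_algebraicClasses_of_mem_algebraicClasses μ (hf.isSmoothProjective s)
      (IsSmoothProjective.tensor_holds hB (hf.isSmoothProjective s)) _ _ hxN, ?_⟩
  refine ⟨K⁻¹ • complexGysin μ hX (IsSmoothProjective.tensor_holds hB hX) (lift (toSpecOver 𝒳 ≫ b₀) (𝟙 𝒳))
      (show 2 * p + 2 * (r + N) = 2 * (p + r) + 2 * N by omega) W, ?_⟩
  change (complexBetti.map (fiberι f s) (2 * p)).hom W = x at hW
  rw [map_smul]
  change K⁻¹ • complexBetti.map (B ◁ fiberι f s) (2 * (p + r)) _ = _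
  rw [hK, smul_smul, inv_mul_cancel₀ hK0, one_smul]
  change complexGysin μ _ _ _ _ ((complexBetti.map (fiberι f s) (2 * p)).hom W) = _
  rw [hW]

include hX hf in
/-- **`σ_{s!}` maps the LIFTED classes `j_s^* N^p(𝒳)` into the lifted classes `(B ◁ j_s)^* N^{p+r}(B × 𝒳)`.** [cite: Fulton1998, Thm. 6.2 (a)] -/
theorem slice_gysin_fiber_mem_map (s : ComplexPoints S) {p : ℕ} {x : complexBetti (fiberOver f s) (2 * p)}
    (hx : x ∈ (algebraicClasses 𝒳 p).map (complexBetti.map (fiberι f s) (2 * p)).hom) :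
    complexGysin μ (hf.isSmoothProjective s) (IsSmoothProjective.tensor_holds hB (hf.isSmoothProjective s))
        (lift (toSpecOver (fiberOver f s) ≫ b₀) (𝟙 (fiberOver f s))) (show 2 * p + 2 * (r + d) = 2 * (p + r) + 2 * d by omega) x ∈
      (algebraicClasses (B ⊗ 𝒳) (p + r)).map (complexBetti.map (B ◁ fiberι f s) (2 * (p + r))).hom := by
  obtain ⟨η, hη, hηx⟩ := hx
  obtain ⟨c, K, -, hK0, -, hK⟩ := exists_ne_zero_baseChange_scalars μ hX hf hB b₀ s
  refine ⟨K⁻¹ • complexGysin μ hX (IsSmoothProjective.tensor_holds hB hX) (lift (toSpecOver 𝒳 ≫ b₀) (𝟙 𝒳))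
      (show 2 * p + 2 * (r + N) = 2 * (p + r) + 2 * N by omega) η,
    Submodule.smul_mem _ _ (complexGysin_mem_algebraicClasses_of_mem_algebraicClasses μ hX
      (IsSmoothProjective.tensor_holds hB hX) _ _ hη), ?_⟩
  rw [map_smul]
  change K⁻¹ • complexBetti.map (B ◁ fiberι f s) (2 * (p + r)) _ = _
  rw [hK, smul_smul, inv_mul_cancel₀ hK0, one_smul]
  change complexGysin μ _ _ _ _ ((complexBetti.map (fiberι f s) (2 * p)).hom η) = _
  rw [hηx]

include hX hB b₀ in
/-- **`σ_{s!}` REFLECTS the lifted classes**: if `x ∈ Im j_s^*` and `σ_{s!} x ∈ (B ◁ j_s)^* N^{p+r}(B × 𝒳)` then `x ∈ j_s^* N^p(𝒳)`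
(`x = pr'_! σ_{s!} x = pr'_! (B ◁ j_s)^* η = c⁻¹ j_s^* pr_! η`). [cite: Fulton1998, Prop. 1.7] -/
theorem mem_map_of_slice_gysin_fiber_mem_map (s : ComplexPoints S) {p : ℕ} {x : complexBetti (fiberOver f s) (2 * p)}
    (hσx : complexGysin μ (hf.isSmoothProjective s) (IsSmoothProjective.tensor_holds hB (hf.isSmoothProjective s))
        (lift (toSpecOver (fiberOver f s) ≫ b₀) (𝟙 (fiberOver f s))) (show 2 * p + 2 * (r + d) = 2 * (p + r) + 2 * d by omega) x ∈
      (algebraicClasses (B ⊗ 𝒳) (p + r)).map (complexBetti.map (B ◁ fiberι f s) (2 * (p + r))).hom) :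
    x ∈ (algebraicClasses 𝒳 p).map (complexBetti.map (fiberι f s) (2 * p)).hom := by
  obtain ⟨η, hη, hηx⟩ := hσx
  obtain ⟨c, K, hc0, -, hc, -⟩ := exists_ne_zero_baseChange_scalars μ hX hf hB b₀ s
  refine ⟨c⁻¹ • complexGysin μ (IsSmoothProjective.tensor_holds hB hX) hX (snd B 𝒳)
      (show 2 * (p + r) + 2 * N = 2 * p + 2 * (r + N) by omega) η,
    Submodule.smul_mem _ _ (complexGysin_mem_algebraicClasses_of_mem_algebraicClasses μ
      (IsSmoothProjective.tensor_holds hB hX) hX _ _ hη), ?_⟩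
  rw [map_smul]
  change c⁻¹ • complexBetti.map (fiberι f s) (2 * p) _ = x
  rw [hc, smul_smul, inv_mul_cancel₀ hc0, one_smul]
  change complexGysin μ _ _ _ _ ((complexBetti.map (B ◁ fiberι f s) (2 * (p + r))).hom η) = x
  rw [hηx, snd_gysin_slice_gysin μ (hf.isSmoothProjective s) hB b₀ p]

end Embedding

/-! ## §3 The lift defect does not decrease under padding -/

/-- **Linear algebra: injectivity on quotients bounds the defects.** For `ψ : M₁ → M₂` linear, `U₁ ≤ V₁`, `U₂ ≤ V₂` with
`ψ V₁ ⊆ V₂`, `ψ U₁ ⊆ U₂` and `V₁ ∩ ψ⁻¹ U₂ ⊆ U₁` (so `V₁/U₁ ↪ V₂/U₂`):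
`dim V₁ + dim U₂ ≤ dim V₂ + dim U₁`, i.e. `dim V₁ − dim U₁ ≤ dim V₂ − dim U₂`. [folklore] -/
theorem finrank_add_finrank_le_of_quotient_injective {K M₁ M₂ : Type*} [DivisionRing K] [AddCommGroup M₁] [Module K M₁]
    [AddCommGroup M₂] [Module K M₂] [FiniteDimensional K M₁] [FiniteDimensional K M₂]
    (ψ : M₁ →ₗ[K] M₂) {U₁ V₁ : Submodule K M₁} {U₂ V₂ : Submodule K M₂} (hU₁ : U₁ ≤ V₁) (hU₂ : U₂ ≤ V₂)
    (hV : ∀ x ∈ V₁, ψ x ∈ V₂) (hUU : ∀ x ∈ U₁, ψ x ∈ U₂) (hrefl : ∀ x ∈ V₁, ψ x ∈ U₂ → x ∈ U₁) :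
    Module.finrank K V₁ + Module.finrank K U₂ ≤ Module.finrank K V₂ + Module.finrank K U₁ := by
  set U₂' : Submodule K V₂ := U₂.comap V₂.subtype with hU₂'
  set ψV : V₁ →ₗ[K] V₂ := (ψ.domRestrict V₁).codRestrict V₂ (fun x ↦ hV x.1 x.2) with hψV
  set Q : V₁ →ₗ[K] V₂ ⧸ U₂' := U₂'.mkQ ∘ₗ ψV with hQ
  have hker : LinearMap.ker Q = U₁.comap V₁.subtype := by
    ext x
    simp only [hQ, hU₂', hψV, LinearMap.mem_ker, LinearMap.comp_apply, Submodule.mkQ_apply,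
      Submodule.Quotient.mk_eq_zero, Submodule.mem_comap, Submodule.subtype_apply, LinearMap.codRestrict_apply,
      LinearMap.domRestrict_apply]
    exact ⟨fun h ↦ hrefl x.1 x.2 h, fun h ↦ hUU x.1 h⟩
  have h1 := LinearMap.finrank_range_add_finrank_ker Q
  have h2 : Module.finrank K (LinearMap.range Q) ≤ Module.finrank K (V₂ ⧸ U₂') := Submodule.finrank_le _
  have h3 := Submodule.finrank_quotient_add_finrank U₂'
  have h4 : Module.finrank K U₂' = Module.finrank K U₂ := (Submodule.comapSubtypeEquivOfLe hU₂).finrank_eq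
  have h5 : Module.finrank K (LinearMap.ker Q) = Module.finrank K U₁ := by
    rw [hker]
    exact (Submodule.comapSubtypeEquivOfLe hU₁).finrank_eq
  omega

/-- **THE LIFT DEFECT DOES NOT DECREASE UNDER PADDING.** For a compact pencil `f` of abelian `d`-folds, an abelian variety `B`, a
point `s` and a degree `p`: with `N_inv := N ∩ Im j^*` (invariant algebraic classes of the fibre) and `r := dim j^* N(total)`
(lifted ones; part XXXI-c), `dim N^p_inv(𝒳_s) − r_p(f) ≤ dim N^{p + dim B}_inv((B × 𝒳)_s) − r_{p + dim B}(B × 𝒳 ⟶ S)`, written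
additively. With part XXX-d (`(L)_s(p) ⟺` defect `0`) this re-proves `(L)_s(p + dim B)[B × 𝒳] ⟹ (L)_s(p)[f]` and quantifies it.
FACT-FREE. [cite: Fulton1998, Prop. 1.7 and Thm. 6.2 (a)] [cite: Milne2020HodgeClassesAV, Prop. 1 (p. 8)] [cite: Kleiman1968AlgebraicCycles, §3] -/
theorem finrank_inf_range_add_le_of_snd_comp {d : ℕ} {f : 𝒳 ⟶ S} (hf : IsCompactAbelianPencil f d) (B : AbelianVariety ℂ)
    (s : ComplexPoints S) (p : ℕ) :
    Module.finrank ℂ ↥(algebraicClasses (fiberOver f s) p ⊓ LinearMap.range (complexBetti.map (fiberι f s) (2 * p)).hom) +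
      Module.finrank ℂ ↥((algebraicClasses (B.X ⊗ 𝒳) (p + B.dim)).map
        (complexBetti.map (fiberι (snd B.X 𝒳 ≫ f) s) (2 * (p + B.dim))).hom) ≤
    Module.finrank ℂ ↥(algebraicClasses (fiberOver (snd B.X 𝒳 ≫ f) s) (p + B.dim) ⊓
        LinearMap.range (complexBetti.map (fiberι (snd B.X 𝒳 ≫ f) s) (2 * (p + B.dim))).hom) +
      Module.finrank ℂ ↥((algebraicClasses 𝒳 p).map (complexBetti.map (fiberι f s) (2 * p)).hom) := by
  let μ : OrientationFamily := fun _ _ h ↦ (Motives.ComplexPoints.isOrientableOver ℂ h).some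
  have hX := hf.isSmoothProjective_total
  have hfam := hf.isSmoothProjectiveFamily
  have hXs : IsSmoothProjective d (fiberOver f s) := hf.isSmoothProjective_fiberOver s
  have hB : IsSmoothProjective B.dim B.X := AbelianVariety.isSmoothProjective_holds
  have hg : IsCompactAbelianPencil (snd B.X 𝒳 ≫ f) (B.dim + d) := isCompactAbelianPencil_snd_comp hf B
  haveI : IsProper S.hom := IsSmoothProjective.isProper_holds hf.isSmoothProjective_base
  haveI : Module.Finite ℂ (complexBetti (fiberOver f s) (2 * p)) := finite_complexBetti hXs (2 * p)
  haveI : Module.Finite ℂ (complexBetti (B.X ⊗ fiberOver f s) (2 * (p + B.dim))) :=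
    finite_complexBetti (IsSmoothProjective.tensor_holds hB hXs) _
  haveI : Module.Finite ℂ (complexBetti (fiberOver (snd B.X 𝒳 ≫ f) s) (2 * (p + B.dim))) :=
    finite_complexBetti (hg.isSmoothProjective_fiberOver s) _
  obtain ⟨e, he⟩ := exists_fiberOver_snd_comp_iso f B.X s
  -- the chart `E = e^*` as a linear equivalence, and the transported submodules
  set E : complexBetti (fiberOver (snd B.X 𝒳 ≫ f) s) (2 * (p + B.dim)) ≃ₗ[ℂ]
      complexBetti (B.X ⊗ fiberOver f s) (2 * (p + B.dim)) :=
    LinearEquiv.ofBijective (complexBetti.map e.hom (2 * (p + B.dim))).hom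
      (complexBetti.bijective_map_of_iso e (2 * (p + B.dim))) with hE
  have hEj : (complexBetti.map (B.X ◁ fiberι f s) (2 * (p + B.dim))).hom =
      (E : _ →ₗ[ℂ] _) ∘ₗ (complexBetti.map (fiberι (snd B.X 𝒳 ≫ f) s) (2 * (p + B.dim))).hom := by
    rw [← he, complexBetti.map_comp]
    rfl
  have hV₂ : (algebraicClasses (fiberOver (snd B.X 𝒳 ≫ f) s) (p + B.dim) ⊓
        LinearMap.range (complexBetti.map (fiberι (snd B.X 𝒳 ≫ f) s) (2 * (p + B.dim))).hom).map (E : _ →ₗ[ℂ] _) =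
      algebraicClasses (B.X ⊗ fiberOver f s) (p + B.dim) ⊓
        LinearMap.range (complexBetti.map (B.X ◁ fiberι f s) (2 * (p + B.dim))).hom := by
    rw [Submodule.map_inf _ E.injective, hEj, LinearMap.range_comp]
    congr 1
    exact algebraicClasses_map_eq_of_iso e (p + B.dim)
  have hU₂ : ((algebraicClasses (B.X ⊗ 𝒳) (p + B.dim)).map
        (complexBetti.map (fiberι (snd B.X 𝒳 ≫ f) s) (2 * (p + B.dim))).hom).map (E : _ →ₗ[ℂ] _) =
      (algebraicClasses (B.X ⊗ 𝒳) (p + B.dim)).map (complexBetti.map (B.X ◁ fiberι f s) (2 * (p + B.dim))).hom := by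
    rw [← Submodule.map_comp, ← hEj]
  rw [← LinearEquiv.finrank_map_eq E (algebraicClasses (fiberOver (snd B.X 𝒳 ≫ f) s) (p + B.dim) ⊓ _),
    ← LinearEquiv.finrank_map_eq E ((algebraicClasses (B.X ⊗ 𝒳) (p + B.dim)).map _), hV₂, hU₂]
  refine finrank_add_finrank_le_of_quotient_injective
    (complexGysin μ hXs (IsSmoothProjective.tensor_holds hB hXs) (lift (toSpecOver (fiberOver f s) ≫ (1 : B.Points ℂ)) (𝟙 _))
      (show 2 * p + 2 * (B.dim + d) = 2 * (p + B.dim) + 2 * d by omega))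
    (map_algebraicClasses_le_inf_range hf s p) ?_ (fun x hx ↦ ?_) (fun x hx ↦ ?_) (fun x hx hψx ↦ ?_)
  · rw [← hV₂, ← hU₂]
    exact Submodule.map_mono (map_algebraicClasses_le_inf_range hg s (p + B.dim))
  · exact slice_gysin_fiber_mem_inf_range μ hX hfam hB (1 : B.Points ℂ) s hx
  · exact slice_gysin_fiber_mem_map μ hX hfam hB (1 : B.Points ℂ) s hx
  · exact mem_map_of_slice_gysin_fiber_mem_map μ hX hfam hB (1 : B.Points ℂ) s hψx

/-- **Rank-form re-derivation of the padding**: `(L)_s(p + dim B)` for `B × 𝒳 ⟶ S` ⟹ `(L)_s(p)` for `f`, through part XXX-d's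
`(L) ⟺ (rank form)` and the defect inequality — consistent with part XXXII-b's direct proof. [cite: Milne2020HodgeClassesAV, Prop. 1 (p. 8)] -/
theorem comap_le_sup_of_snd_comp_of_finrank {d : ℕ} {f : 𝒳 ⟶ S} (hf : IsCompactAbelianPencil f d) (B : AbelianVariety ℂ)
    (s : ComplexPoints S) (p : ℕ)
    (h : (algebraicClasses (fiberOver (snd B.X 𝒳 ≫ f) s) (p + B.dim)).comap
        (complexBetti.map (fiberι (snd B.X 𝒳 ≫ f) s) (2 * (p + B.dim))).hom ≤
      algebraicClasses (B.X ⊗ 𝒳) (p + B.dim) ⊔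
        LinearMap.ker (complexBetti.map (fiberι (snd B.X 𝒳 ≫ f) s) (2 * (p + B.dim))).hom) :
    (algebraicClasses (fiberOver f s) p).comap (complexBetti.map (fiberι f s) (2 * p)).hom ≤
      algebraicClasses 𝒳 p ⊔ LinearMap.ker (complexBetti.map (fiberι f s) (2 * p)).hom := by
  have hg : IsCompactAbelianPencil (snd B.X 𝒳 ≫ f) (B.dim + d) := isCompactAbelianPencil_snd_comp hf B
  rw [comap_le_sup_iff_finrank_le hf s p]
  have h1 := (comap_le_sup_iff_finrank_le hg s (p + B.dim)).1 h
  have h2 := finrank_inf_range_add_le_of_snd_comp hf B s p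
  omega

end Summit.HodgeConjecture.HodgeConjecture.Ring2.AbelianAll

end
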